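import Literature.NumberTheory.Automorphic.JacquetShalikaSchurSelfSumOfTorusFiniteness
import Literature.NumberTheory.Automorphic.SatakeParameterUnitBound
import Literature.NumberTheory.Automorphic.JacquetShalikaEulerProductsProofs
import HarnessLib

/-!
# `multipliable_partialStandardL` and its siblings from the finiteness of the unfolded
# Rankin–Selberg integral

Topic `NumberTheory/Automorphic`; namespace `Literature.NumberTheory.Automorphic`. Proof file
(theorems only). `JacquetShalikaSchurSelfSumOfTorusFiniteness` reduces the named fact
`JacquetShalika1981_schurSelfSum_prod_bounded` (Jacquet–Shalika (1981), (5.3.3)–(5.3.4) off large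
finite sets) to the finiteness of the unfolded Rankin–Selberg torus integral for the smoothed vectors
of the cuspidal representation (hypothesis `hfin`, the upper half of the real-point method), in every
rank `n ≥ 1`. This file records the same reduction for the facts reached through it in the tree, in
**every** rank (ranks `≤ 1` being unconditional, `SatakeParameterUnitBound`):

* `multipliable_partialStandardL_of_rankinSelbergTorusIntegral_ne_top` — Jacquet–Shalika's
  Thm. (5.3) with Remark (5.4): the partial standard Euler product of a cuspidal `Π` is multipliable
  for `re s > 1` (`multipliable_partialStandardL`), from `hfin`;
* `absolutelyConvergent_partialStandardL_of_rankinSelbergTorusIntegral_ne_top` — the same for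
  `absolutelyConvergent_partialStandardL`;
* `summable_normSq_trace_largeFinset_of_rankinSelbergTorusIntegral_ne_top`,
  `multipliable_L_of_rankinSelbergTorusIntegral_ne_top`,
  `continuation_partialPairL_conj_of_rankinSelbergTorusIntegral_ne_top` — (J), the full Euler product
  `StandardLFunctionData.multipliable_L` and Lemma (5.2)
  (`JacquetShalika1981_continuation_partialPairL_conj`) for `1 ≤ n`, from `hfin`.

## References

* H. Jacquet, J. A. Shalika, *On Euler products and the classification of automorphic
  representations I*, Amer. J. Math. 103 (1981), Lemma (5.2), Thm. (5.3), Remark (5.4),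
  (5.3.3)–(5.3.4) [JacquetShalikaAJM1981].
-/

noncomputable section

open MeasureTheory Measure NumberField IsDedekindDomain
open scoped MatrixGroups ENNReal NNReal
open Literature.NumberTheory.GaloisRepresentations (ideleGroup)

namespace Literature.NumberTheory.Automorphic

section OfTorusFiniteness

variable {n : ℕ} {K : Type} [Field K] [NumberField K]
  {μ : Measure (AdelicGroupData.gl n K).automorphicQuotient}
  [(AdelicGroupData.gl n K).IsAutomorphicMeasure μ]

attribute [local instance] adelicBorel borelSpace_adelic locallyCompactSpace_adelic
  secondCountableTopology_gl_adelic glAdeleBorel borelSpace_glAdele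

/-- **Jacquet–Shalika's Theorem (5.3) from the finiteness of the unfolded Rankin–Selberg integral**,
in every rank: `multipliable_partialStandardL` (the partial standard Euler product of a cuspidal `Π` of
`GL_n(𝔸_K)` is multipliable for `re s > 1`) follows from the hypothesis `hfin` of
`JacquetShalika1981_schurSelfSum_prod_bounded_of_rankinSelbergTorusIntegral_ne_top` (ranks `≤ 1` are
unconditional, `multipliable_partialStandardL_of_le_one`).
[cite: JacquetShalikaAJM1981, Thm. (5.3), Remark (5.4)] -/
theorem multipliable_partialStandardL_of_rankinSelbergTorusIntegral_ne_top
    [MeasurableSpace (ideleGroup K)] [BorelSpace (ideleGroup K)]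
    (νA : Measure (Fin n → ideleGroup K)) [νA.IsMulLeftInvariant] [SFinite νA] [νA.IsOpenPosMeasure]
    (νK : Measure ↥(maximalCompactAdelic n K)) [SFinite νK] [νK.IsOpenPosMeasure]
    (ν₀ : Measure ↥(adelicUnipotent n K)) [IsHaarMeasure ν₀]
    {Φinf : (Fin n → InfiniteAdeleRing K) → ℝ} (hΦc : Continuous Φinf) (hΦ : ∀ z, 0 < Φinf z)
    (hfin : ∀ (η : (AdelicGroupData.gl n K).Adelic → ℝ), IsTestFunctionGL n K η →
      ∀ (f : (AdelicGroupData.gl n K).L2 μ), f ∈ cuspidalSubspace n K μ → ∀ ⦃σ : ℝ⦄, 1 < σ →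
        rankinSelbergTorusIntegral n K νA νK
          (whittakerCoeff ν₀ (unipotentTateDomain n K) (adeleAddChar K)
            (invQuot (AdelicGroupData.gl n K) (smoothedForm η f)))
          (standardTestFun n K Φinf) σ ≠ ⊤) :
    multipliable_partialStandardL (μ := μ) := by
  rcases Nat.lt_or_ge n 1 with h | h
  · exact multipliable_partialStandardL_of_le_one (by omega)
  · exact multipliable_partialStandardL_of_schurSelfSum_prod_bounded
      (JacquetShalika1981_schurSelfSum_prod_bounded_of_rankinSelbergTorusIntegral_ne_top h νA νK ν₀
        hΦc hΦ hfin)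

/-- `absolutelyConvergent_partialStandardL` from `hfin`, in every rank.
[cite: JacquetShalikaAJM1981, Thm. (5.3), Remark (5.4)] -/
theorem absolutelyConvergent_partialStandardL_of_rankinSelbergTorusIntegral_ne_top
    [MeasurableSpace (ideleGroup K)] [BorelSpace (ideleGroup K)]
    (νA : Measure (Fin n → ideleGroup K)) [νA.IsMulLeftInvariant] [SFinite νA] [νA.IsOpenPosMeasure]
    (νK : Measure ↥(maximalCompactAdelic n K)) [SFinite νK] [νK.IsOpenPosMeasure]
    (ν₀ : Measure ↥(adelicUnipotent n K)) [IsHaarMeasure ν₀]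
    {Φinf : (Fin n → InfiniteAdeleRing K) → ℝ} (hΦc : Continuous Φinf) (hΦ : ∀ z, 0 < Φinf z)
    (hfin : ∀ (η : (AdelicGroupData.gl n K).Adelic → ℝ), IsTestFunctionGL n K η →
      ∀ (f : (AdelicGroupData.gl n K).L2 μ), f ∈ cuspidalSubspace n K μ → ∀ ⦃σ : ℝ⦄, 1 < σ →
        rankinSelbergTorusIntegral n K νA νK
          (whittakerCoeff ν₀ (unipotentTateDomain n K) (adeleAddChar K)
            (invQuot (AdelicGroupData.gl n K) (smoothedForm η f)))
          (standardTestFun n K Φinf) σ ≠ ⊤) :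
    absolutelyConvergent_partialStandardL (μ := μ) := by
  rcases Nat.lt_or_ge n 1 with h | h
  · exact absolutelyConvergent_partialStandardL_of_le_one (by omega)
  · exact absolutelyConvergent_partialStandardL_of_schurSelfSum_prod_bounded
      (JacquetShalika1981_schurSelfSum_prod_bounded_of_rankinSelbergTorusIntegral_ne_top h νA νK ν₀
        hΦc hΦ hfin)

/-- (J) = `summable_normSq_trace_largeFinset` from `hfin`, for `1 ≤ n`.
[cite: JacquetShalikaAJM1981, Thm. (5.3), proof, (5.3.3)–(5.3.4)] -/
theorem summable_normSq_trace_largeFinset_of_rankinSelbergTorusIntegral_ne_top (hn : 1 ≤ n)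
    [MeasurableSpace (ideleGroup K)] [BorelSpace (ideleGroup K)]
    (νA : Measure (Fin n → ideleGroup K)) [νA.IsMulLeftInvariant] [SFinite νA] [νA.IsOpenPosMeasure]
    (νK : Measure ↥(maximalCompactAdelic n K)) [SFinite νK] [νK.IsOpenPosMeasure]
    (ν₀ : Measure ↥(adelicUnipotent n K)) [IsHaarMeasure ν₀]
    {Φinf : (Fin n → InfiniteAdeleRing K) → ℝ} (hΦc : Continuous Φinf) (hΦ : ∀ z, 0 < Φinf z)
    (hfin : ∀ (η : (AdelicGroupData.gl n K).Adelic → ℝ), IsTestFunctionGL n K η →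
      ∀ (f : (AdelicGroupData.gl n K).L2 μ), f ∈ cuspidalSubspace n K μ → ∀ ⦃σ : ℝ⦄, 1 < σ →
        rankinSelbergTorusIntegral n K νA νK
          (whittakerCoeff ν₀ (unipotentTateDomain n K) (adeleAddChar K)
            (invQuot (AdelicGroupData.gl n K) (smoothedForm η f)))
          (standardTestFun n K Φinf) σ ≠ ⊤) :
    summable_normSq_trace_largeFinset (μ := μ) :=
  summable_normSq_trace_largeFinset_of_schurSelfSum_prod_bounded
    (JacquetShalika1981_schurSelfSum_prod_bounded_of_rankinSelbergTorusIntegral_ne_top hn νA νK ν₀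
      hΦc hΦ hfin)

/-- The full Euler product `StandardLFunctionData.multipliable_L` from `hfin`, for `1 ≤ n`.
[cite: JacquetShalikaAJM1981, Thm. (5.3)] -/
theorem multipliable_L_of_rankinSelbergTorusIntegral_ne_top (hn : 1 ≤ n)
    [MeasurableSpace (ideleGroup K)] [BorelSpace (ideleGroup K)]
    (νA : Measure (Fin n → ideleGroup K)) [νA.IsMulLeftInvariant] [SFinite νA] [νA.IsOpenPosMeasure]
    (νK : Measure ↥(maximalCompactAdelic n K)) [SFinite νK] [νK.IsOpenPosMeasure]
    (ν₀ : Measure ↥(adelicUnipotent n K)) [IsHaarMeasure ν₀]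
    {Φinf : (Fin n → InfiniteAdeleRing K) → ℝ} (hΦc : Continuous Φinf) (hΦ : ∀ z, 0 < Φinf z)
    (hfin : ∀ (η : (AdelicGroupData.gl n K).Adelic → ℝ), IsTestFunctionGL n K η →
      ∀ (f : (AdelicGroupData.gl n K).L2 μ), f ∈ cuspidalSubspace n K μ → ∀ ⦃σ : ℝ⦄, 1 < σ →
        rankinSelbergTorusIntegral n K νA νK
          (whittakerCoeff ν₀ (unipotentTateDomain n K) (adeleAddChar K)
            (invQuot (AdelicGroupData.gl n K) (smoothedForm η f)))
          (standardTestFun n K Φinf) σ ≠ ⊤)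
    {P : CuspidalAutomorphicRepGL n K μ} :
    StandardLFunctionData.multipliable_L (P := P) :=
  StandardLFunctionData.multipliable_L_of_schurSelfSum_prod_bounded
    (JacquetShalika1981_schurSelfSum_prod_bounded_of_rankinSelbergTorusIntegral_ne_top hn νA νK ν₀
      hΦc hΦ hfin)

/-- Lemma (5.2) (`JacquetShalika1981_continuation_partialPairL_conj`) from `hfin`, for `1 ≤ n`.
[cite: JacquetShalikaAJM1981, Lemma (5.2)] -/
theorem continuation_partialPairL_conj_of_rankinSelbergTorusIntegral_ne_top (hn : 1 ≤ n)
    [MeasurableSpace (ideleGroup K)] [BorelSpace (ideleGroup K)]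
    (νA : Measure (Fin n → ideleGroup K)) [νA.IsMulLeftInvariant] [SFinite νA] [νA.IsOpenPosMeasure]
    (νK : Measure ↥(maximalCompactAdelic n K)) [SFinite νK] [νK.IsOpenPosMeasure]
    (ν₀ : Measure ↥(adelicUnipotent n K)) [IsHaarMeasure ν₀]
    {Φinf : (Fin n → InfiniteAdeleRing K) → ℝ} (hΦc : Continuous Φinf) (hΦ : ∀ z, 0 < Φinf z)
    (hfin : ∀ (η : (AdelicGroupData.gl n K).Adelic → ℝ), IsTestFunctionGL n K η →
      ∀ (f : (AdelicGroupData.gl n K).L2 μ), f ∈ cuspidalSubspace n K μ → ∀ ⦃σ : ℝ⦄, 1 < σ →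
        rankinSelbergTorusIntegral n K νA νK
          (whittakerCoeff ν₀ (unipotentTateDomain n K) (adeleAddChar K)
            (invQuot (AdelicGroupData.gl n K) (smoothedForm η f)))
          (standardTestFun n K Φinf) σ ≠ ⊤) :
    JacquetShalika1981_continuation_partialPairL_conj (μ := μ) :=
  JacquetShalika1981_continuation_partialPairL_conj_of_schurSelfSum_prod_bounded
    (JacquetShalika1981_schurSelfSum_prod_bounded_of_rankinSelbergTorusIntegral_ne_top hn νA νK ν₀
      hΦc hΦ hfin)

end OfTorusFiniteness

end Literature.NumberTheory.Automorphic
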